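import Summits.ResolutionOfSingularities.ResolutionOfSingularities.Theorems.MarkedTransferCampaignW46MohWindowShadeFormalNRChart
import Summits.ResolutionOfSingularities.ResolutionOfSingularities.Theorems.MarkedTransferCampaignW46MohWindowShadeFormalInsepStepCore
import Summits.ResolutionOfSingularities.ResolutionOfSingularities.Theorems.WildConesCampaignW46FormalChartAssembly
import HarnessLib

/-!
# [OURS · L1 W4.6 rung (iii-2), NON-RATIONAL POINTS, brick 2] The controlled transform of a series anchor at a NON-RATIONAL point of
# the point blow-up (ring level): the new anchor lives over the residue field `K(λ)` of the point; its model series is the series step,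
# over `K(λ)`, at the now-rational translated point `λ`

Cell `res-hironaka`, LADDER-RESOLUTION rung L (D-0089), slot W4.6 rung (iii); seat res-L1-s46-pv-6 (gen 7). Host route MarkedTransfer,
`--supports stmt-ResolutionOfSingularities-16155 --as helper`; kind proof (no definition). NON-RATIONAL twin of this seat's gen-6
`…FormalInsepStepCore` (p547485): the SAME anchor identity, cancellation of `u_{i₀}^p`, singularity ⇒ no constant ⇒ equimultiple point — but
the chart data of the point are NON-RATIONAL (`𝔪_L = (g c_{i₀}, e_z, π̃^g(e_{u_{i₁}}))`, `π̃ ∈ R[X]` monic with irreducible reduction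
`π ∈ K[X]`; every element of `L` a polynomial in `e_{u_{i₁}}` modulo `𝔪_L`), the recognition is `…FormalNRChart.exists_ringEquiv_chart_nr`
(coefficient field `K′ = K(λ) = AdjoinRoot π`), `E′ ∘ ĝ ∘ E₀⁻¹ : K⟦z,u⟧ → K′⟦z,u⟧` is the germ chart substitution over `K′` after the
coefficient extension (`ringHom_eq_subst_map_chartGerm`), and the model series upstairs is `(S₀^{K′}).step p i₀ b`, `b = (i₀ ↦ 0, i₁ ↦ λ)`.
OURS; NOT a statement of the manuscript [claim: Hironaka2017, status: under-review] (Def. 2.1 p.5 «the transform `E′`» — scope only),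
nothing of which is used; no FACT-LIST premise. AI-written; AI review is weaker than expert review. References: H. Matsumura (1986)
Thm. 8.3, 8.11, 28.3, 29.7; H. Hauser, Bull. AMS 47 (2010) §§F–G. [Matsumura1987] [Hauser2010] [folklore]
-/

noncomputable section

set_option linter.dupNamespace false -- mandated namespace of this single-conjunct summit

open IsLocalRing MvPolynomial

namespace Summit.ResolutionOfSingularities.ResolutionOfSingularities.Theorems

namespace CampaignW46

namespace MohWindowShadeFormalNR

open Literature.AlgebraicGeometry.Resolution
open Literature.AlgebraicGeometry.Resolution.PointBlowup
open Literature.AlgebraicGeometry.Resolution.Hauser2010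
open MohWindowShadePS
open MohWindowShadeFormalInsep (Series.exists_add_pow_eq_step_F Series.subst_chartSubst_eq Series.isEquimultiplePoint_of_le_order_add_C
  Series.constantCoeff_step_F)
open CampaignW46.FormalChart
open CampaignW46.AtomGerm (hasSubst_chartGerm rename_chartSubst_self rename_chartSubst_of_ne subst_chartGerm_rename
  exists_isUnit_image_adapted X_some_ne_zero kill_rename_some kill_rename_sub_C constantCoeff_rename_some mem_maximalIdeal_pow_iff_algebraMap
  mem_maximalIdeal_pow_of_rename_some)
open Literature.RingTheory.MvPowerSeries.Jets (mem_maximalIdeal_iff_constantCoeff_eq_zero le_order_of_mem_maximalIdeal_pow)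
open Summit.ResolutionOfSingularities.ResolutionOfSingularities.Theorems.FrobeniusClosing (chartSubst)

/-! ## The transform of a series anchor at a non-rational point of the point blow-up (ring level) -/

section Transform

variable {p : ℕ} [hp : Fact p.Prime] {K : Type} [Field K] [CharP K p] [PerfectRing K p]
  {R : Type} [CommRing R] [IsLocalRing R] [IsNoetherianRing R]
  {L : Type} [CommRing L] [IsLocalRing L] [IsNoetherianRing L]
  (g : R →+* L) (hg : (maximalIdeal R).map g ≤ maximalIdeal L)
  (E₀ : AdicCompletion (maximalIdeal R) R ≃+* MvPowerSeries (Option (Fin 2)) K)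
  (c : Option (Fin 2) → R) (hc : Ideal.span (Set.range c) = maximalIdeal R)
  (hcX : ∀ j, E₀ (algebraMap R (AdicCompletion (maximalIdeal R) R) (c j)) - MvPowerSeries.X j ∈
    maximalIdeal (MvPowerSeries (Option (Fin 2)) K) ^ 2)
  {i₀ i₁ : Fin 2} (hi : i₁ ≠ i₀) (htwo : ∀ l, l = i₀ ∨ l = i₁)
  (e : Option (Fin 2) → L) (he : ∀ j, g (c j) = g (c (some i₀)) * e j)
  (πR : Polynomial R) (hπm : πR.Monic) (π : Polynomial K) [hπ : Fact (Irreducible π)]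
  (hπR : πR.map ((MvPowerSeries.constantCoeff.comp (E₀ : _ →+* MvPowerSeries (Option (Fin 2)) K)).comp
    (algebraMap R (AdicCompletion (maximalIdeal R) R))) = π)
  (hgen : Ideal.span {g (c (some i₀)), e none, (πR.map g).eval (e (some i₁))} = maximalIdeal L)
  (hres : ∀ y : L, ∃ P : Polynomial R, y - (P.map g).eval (e (some i₁)) ∈ maximalIdeal L)
  (hdim : ringKrullDim L = 3)

include hg hc he hcX hgen hres hdim hi htwo hπm hπR in
/-- [OURS · L1 W4.6 rung (iii-2) — THE RING-LEVEL STEP AT A NON-RATIONAL POINT; replaces the role of «the transform `E′` of `E` by the blowup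
with center `D`» (H. Hironaka, ms. 2017, Def. 2.1 p.5) for a formally purely inseparable germ `z^p + F(u)`, `F` ANY power series, at a
NON-RATIONAL closed point of the point blow-up; NOT a statement of the manuscript] **The controlled transform of a series anchor at a
non-rational point is a series anchor over the residue field of the point.** Let `g : R → L` be local (`π^♯` on stalks), `E₀ : R̂ ≅ K⟦z,u⟧`
Cohen coordinates adapted to the generators `c` of `𝔪_R` to first order, `g(c_j) = g(c_{i₀}) e_j` (chart `u_{i₀}`), and let the point be cut
out by `𝔪_L = (g c_{i₀}, e_z, π̃^g(e_{u_{i₁}}))` with `π̃ ∈ R[X]` monic whose reduction `π ∈ K[X]` (coefficients read through `E₀`) is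
irreducible, every element of `L` being an `R`-polynomial in `e_{u_{i₁}}` modulo `𝔪_L`, `dim L = 3`. If `E₀(f₀) = w₀ · (z^p + F(u))` with
`F = S₀.F` of order `o ≥ p`, `g f₀ = g(c_{i₀})^p · f′` and `f′ ∈ 𝔪_L^p` (the point is singular for the controlled transform), then there are
Cohen coordinates `E′ : L̂ ≅ K′⟦z,u⟧`, `K′ = AdjoinRoot π = K(λ)`, extending the coefficients along `K → K′`, with
`E′(f′) = w′ · (z^p + F′(u))`, `F′ = (S₀^{K′}.step p i₀ b).F` the SERIES STEP over `K′` at the translated point `b = (i₀ ↦ 0, i₁ ↦ λ)`, an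
EQUIMULTIPLE point of `S₀^{K′} = (F ⊗ K′, r)`. (Hauser–Wagner frame: if `i₀ = 1` the point must be the origin, `π = X`.)
[cite: Matsumura1987, Thm. 8.11] [cite: Hauser2010, §§F–G (point blowup followed by cleaning)] -/
theorem exists_ringEquiv_transform_seriesAnchor_nr (S₀ : Series (Fin 2) K) {o : ℕ} (ho : S₀.F.order = o) (hpo : p ≤ o) (f₀ : R)
    (w₀ : MvPowerSeries (Option (Fin 2)) K) (hw₀ : IsUnit w₀)
    (hf₀ : E₀ (algebraMap R (AdicCompletion (maximalIdeal R) R) f₀) =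
      w₀ * (MvPowerSeries.X none ^ p + MvPowerSeries.rename (some : Fin 2 → Option (Fin 2)) S₀.F))
    (hHW : i₀ = 1 → π = Polynomial.X)
    (f' : L) (hf' : g f₀ = g (c (some i₀)) ^ p * f') (hf'𝔪 : f' ∈ maximalIdeal L ^ p) :
    ∃ (E' : AdicCompletion (maximalIdeal L) L ≃+* MvPowerSeries (Option (Fin 2)) (AdjoinRoot π))
      (w' : MvPowerSeries (Option (Fin 2)) (AdjoinRoot π)), IsUnit w' ∧
      (∀ l : K, E' ((adicCompletionMap (maximalIdeal R) (maximalIdeal L) g hg) (E₀.symm (MvPowerSeries.C l))) =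
        MvPowerSeries.C (AdjoinRoot.of π l)) ∧
      (i₀ = 1 → ∀ l, (fun l : Fin 2 => if l = i₀ then (0 : AdjoinRoot π) else AdjoinRoot.root π) l = 0) ∧
      Series.IsEquimultiplePoint p i₀ (fun l : Fin 2 => if l = i₀ then (0 : AdjoinRoot π) else AdjoinRoot.root π)
        (⟨MvPowerSeries.map (AdjoinRoot.of π) S₀.F, S₀.r⟩ : Series (Fin 2) (AdjoinRoot π)) ∧
      E' (algebraMap L (AdicCompletion (maximalIdeal L) L) f') =
        w' * (MvPowerSeries.X none ^ p + MvPowerSeries.rename (some : Fin 2 → Option (Fin 2))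
          ((⟨MvPowerSeries.map (AdjoinRoot.of π) S₀.F, S₀.r⟩ : Series (Fin 2) (AdjoinRoot π)).step p i₀
            (fun l : Fin 2 => if l = i₀ then (0 : AdjoinRoot π) else AdjoinRoot.root π)).F) := by
  classical
  -- the grown coefficient field
  set K' := AdjoinRoot π with hK'
  haveI : PerfectField K := PerfectRing.toPerfectField K p
  haveI : Module.Finite K K' := (AdjoinRoot.powerBasis hπ.out.ne_zero).finite
  haveI : PerfectField K' := Algebra.IsAlgebraic.perfectField K
  haveI : CharP K' p := charP_of_injective_ringHom (AdjoinRoot.of π).injective p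
  haveI : PerfectRing K' p := PerfectField.toPerfectRing p
  haveI : CharP (MvPowerSeries (Option (Fin 2)) K') p :=
    charP_of_injective_algebraMap (algebraMap K' (MvPowerSeries (Option (Fin 2)) K')).injective p
  set ιK : K →+* K' := AdjoinRoot.of π with hιK
  set S₁ : Series (Fin 2) K' := ⟨MvPowerSeries.map ιK S₀.F, S₀.r⟩ with hS₁
  have hS₁F : S₁.F = MvPowerSeries.map ιK S₀.F := rfl
  have ho₁ : S₁.F.order = o := by rw [hS₁F, order_map_of_injective ιK ιK.injective, ho]
  set ĝ := adicCompletionMap (maximalIdeal R) (maximalIdeal L) g hg with hĝ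
  set φ : (MvPowerSeries (Option (Fin 2)) K) →+* AdicCompletion (maximalIdeal L) L := ĝ.comp E₀.symm.toRingHom with hφ
  set ofL := algebraMap L (AdicCompletion (maximalIdeal L) L) with hofL
  set ofR := algebraMap R (AdicCompletion (maximalIdeal R) R) with hofR
  set ev₀ : R →+* K := (MvPowerSeries.constantCoeff.comp (E₀ : _ →+* MvPowerSeries (Option (Fin 2)) K)).comp ofR with hev₀
  set v := ofL (g (c (some i₀))) with hv
  have hφE₀ : ∀ x, φ (E₀ x) = ĝ x := fun x => by
    rw [hφ, RingHom.comp_apply]; change ĝ (E₀.symm (E₀ x)) = ĝ x; rw [RingEquiv.symm_apply_apply]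
  have hφapp : ∀ f, φ f = ĝ (E₀.symm f) := fun f => rfl
  have hĝ_of : ∀ x : R, ĝ (ofR x) = ofL (g x) := fun x => by rw [hofR, hofL, hĝ, adicCompletionMap_algebraMap]
  haveI : IsNoetherianRing (AdicCompletion (maximalIdeal L) L) := isNoetherianRing_adicCompletion_maximalIdeal L
  have h𝔪C : maximalIdeal (AdicCompletion (maximalIdeal L) L) = (maximalIdeal L).map ofL := AdicCompletion.maximalIdeal_eq_map
  have hv𝔪 : v ∈ maximalIdeal (AdicCompletion (maximalIdeal L) L) := by
    rw [h𝔪C]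
    exact Ideal.mem_map_of_mem _ (hg (Ideal.mem_map_of_mem _ (hc ▸ Ideal.subset_span ⟨some i₀, rfl⟩)))
  -- `ĝ` of an element of `𝔪_R̂` is a multiple of `v`; in particular `φ` of a series without constant term
  have hĝ𝔪 : ∀ {x}, x ∈ maximalIdeal (AdicCompletion (maximalIdeal R) R) → ĝ x ∈ Ideal.span {v} := fun hx =>
    map_maximalIdeal_completion_le g hg c hc (some i₀) e he (Ideal.mem_map_of_mem _ hx)
  have hφ𝔪 : ∀ {f : MvPowerSeries (Option (Fin 2)) K}, MvPowerSeries.constantCoeff f = 0 → φ f ∈ Ideal.span {v} := fun {f} hf => by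
    rw [hφapp]
    exact hĝ𝔪 (ringEquiv_mem_maximalIdeal E₀.symm (mem_maximalIdeal_iff_constantCoeff_eq_zero.mpr hf))
  -- coefficients read through `E₀` versus through `g`: congruent modulo `(v)`
  have hcoef : ∀ r : R, ofL (g r) - φ (MvPowerSeries.C (ev₀ r)) ∈ Ideal.span {v} := fun r => by
    rw [← hĝ_of, ← hφE₀, ← map_sub]
    exact hφ𝔪 (by rw [map_sub, MvPowerSeries.constantCoeff_C, hev₀]; simp [hofR])
  -- second-order discrepancy: `φ(X_j) = v (e_j − v b_j)`, `φ(X_{i₀}) = v (1 − v b)`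
  have hX : ∀ j, ∃ b, φ (MvPowerSeries.X j) = v * (ofL (e j) - v * b) := fun j => by
    have h2 : E₀.symm (E₀ (ofR (c j)) - MvPowerSeries.X j) ∈ maximalIdeal (AdicCompletion (maximalIdeal R) R) ^ 2 :=
      ringEquiv_mem_maximalIdeal_pow E₀.symm (hcX j)
    obtain ⟨b, hb⟩ := exists_eq_mul_of_mem_maximalIdeal_pow g hg c hc (some i₀) e he h2
    refine ⟨b, ?_⟩
    rw [map_sub, RingEquiv.symm_apply_apply, map_sub] at hb
    rw [hφapp, ← sub_sub_cancel (ĝ (ofR (c j))) (ĝ (E₀.symm (MvPowerSeries.X j))), hb, hĝ_of, he j, map_mul, ← hv]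
    ring
  have hXi : ∃ b, φ (MvPowerSeries.X (some i₀)) = v * (1 - v * b) := by
    have h2 : E₀.symm (E₀ (ofR (c (some i₀))) - MvPowerSeries.X (some i₀)) ∈ maximalIdeal (AdicCompletion (maximalIdeal R) R) ^ 2 :=
      ringEquiv_mem_maximalIdeal_pow E₀.symm (hcX (some i₀))
    obtain ⟨b, hb⟩ := exists_eq_mul_of_mem_maximalIdeal_pow g hg c hc (some i₀) e he h2
    refine ⟨b, ?_⟩
    rw [map_sub, RingEquiv.symm_apply_apply, map_sub] at hb
    rw [hφapp, ← sub_sub_cancel (ĝ (ofR (c (some i₀)))) (ĝ (E₀.symm (MvPowerSeries.X (some i₀)))), hb, hĝ_of, ← hv]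
    ring
  choose bq hbq using hX
  obtain ⟨bi, hbi⟩ := hXi
  have hw : IsUnit (1 - v * bi) := IsLocalRing.isUnit_one_sub_self_of_mem_nonunits _ (Ideal.mul_mem_right _ _ hv𝔪)
  set w := hw.unit with hw_def
  have hwval : (w : AdicCompletion (maximalIdeal L) L) = 1 - v * bi := by rw [hw_def, IsUnit.unit_spec]
  set e' : Option (Fin 2) → AdicCompletion (maximalIdeal L) L := fun j => (ofL (e j) - v * bq j) * (w⁻¹ : (AdicCompletion (maximalIdeal L) L)ˣ)
    with he'def
  have hww : (w : AdicCompletion (maximalIdeal L) L) * (w⁻¹ : (AdicCompletion (maximalIdeal L) L)ˣ) = 1 := Units.mul_inv w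
  have he' : ∀ j, j ≠ some i₀ → φ (MvPowerSeries.X j) = φ (MvPowerSeries.X (some i₀)) * e' j := by
    intro j _
    rw [hbq j, hbi, ← hwval, he'def]
    linear_combination (-(v * (ofL (e j) - v * bq j))) * hww
  have hv_eq : v = φ (MvPowerSeries.X (some i₀)) * (w⁻¹ : (AdicCompletion (maximalIdeal L) L)ˣ) := by
    rw [hbi, ← hwval, mul_assoc, Units.mul_inv, mul_one]
  have he'_sub : ∀ j, e' j - ofL (e j) ∈ Ideal.span {v} := fun j => by
    have e1 : e' j - ofL (e j) = v * ((ofL (e j) * bi - bq j) * (w⁻¹ : (AdicCompletion (maximalIdeal L) L)ˣ)) := by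
      rw [he'def]; linear_combination (ofL (e j)) * hww - (ofL (e j) * (w⁻¹ : (AdicCompletion (maximalIdeal L) L)ˣ)) * hwval
    rw [e1]
    exact Ideal.mul_mem_right _ _ (Ideal.subset_span rfl)
  -- the two readings of the minimal polynomial: `π̃^{ofL g}` and `π^{φ C}` are congruent modulo `(v)`
  set ιT : K →+* AdicCompletion (maximalIdeal L) L := φ.comp MvPowerSeries.C with hιT
  have hπcoef : ∀ n, (πR.map (ofL.comp g)).coeff n - (π.map ιT).coeff n ∈ Ideal.span {v} := fun n => by
    rw [← hπR, Polynomial.map_map, Polynomial.coeff_map, Polynomial.coeff_map]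
    exact hcoef _
  have hPcoef : ∀ (P : Polynomial R) n, (P.map (ofL.comp g)).coeff n - ((P.map ev₀).map ιT).coeff n ∈ Ideal.span {v} := fun P n => by
    rw [Polynomial.map_map, Polynomial.coeff_map, Polynomial.coeff_map]
    exact hcoef _
  have hspan_v : Ideal.span {v} ≤ maximalIdeal (AdicCompletion (maximalIdeal L) L) := (Ideal.span_singleton_le_iff_mem _).2 hv𝔪
  have hofLeval : ∀ P : Polynomial R, ofL ((P.map g).eval (e (some i₁))) = (P.map (ofL.comp g)).eval (ofL (e (some i₁))) := fun P => by
    rw [Polynomial.eval_map, Polynomial.hom_eval₂, ← Polynomial.eval_map]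
  have hgenC : Ideal.span {v, ofL (e none), (πR.map (ofL.comp g)).eval (ofL (e (some i₁)))} =
      maximalIdeal (AdicCompletion (maximalIdeal L) L) := by
    have hmap := congrArg (Ideal.map ofL) hgen
    rw [Ideal.map_span, Set.image_insert_eq, Set.image_insert_eq, Set.image_singleton, hofLeval] at hmap
    rw [h𝔪C, ← hmap]
  have hgen' : Ideal.span {φ (MvPowerSeries.X (some i₀)), e' none, (π.map ιT).eval (e' (some i₁))} =
      maximalIdeal (AdicCompletion (maximalIdeal L) L) := by
    rw [← hgenC]
    have hdiff : (πR.map (ofL.comp g)).eval (ofL (e (some i₁))) - (π.map ιT).eval (e' (some i₁)) ∈ Ideal.span {v} :=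
      eval_sub_eval_mem_of_coeff hπcoef (by rw [← Ideal.neg_mem_iff, neg_sub]; exact he'_sub _)
    apply le_antisymm
    · -- new ⊆ old
      have hv_old : v ∈ Ideal.span {v, ofL (e none), (πR.map (ofL.comp g)).eval (ofL (e (some i₁)))} := Ideal.subset_span (by simp)
      have hsv : Ideal.span {v} ≤ Ideal.span {v, ofL (e none), (πR.map (ofL.comp g)).eval (ofL (e (some i₁)))} :=
        (Ideal.span_singleton_le_iff_mem _).2 hv_old
      rw [Ideal.span_le]
      rintro t ht
      simp only [Set.mem_insert_iff, Set.mem_singleton_iff] at ht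
      rw [SetLike.mem_coe]
      rcases ht with rfl | rfl | rfl
      · rw [hbi]; exact Ideal.mul_mem_right _ _ hv_old
      · have e1 : e' none = ofL (e none) + (e' none - ofL (e none)) := by ring
        rw [e1]
        exact Ideal.add_mem _ (Ideal.subset_span (by simp)) (hsv (he'_sub none))
      · have e1 : (π.map ιT).eval (e' (some i₁)) = (πR.map (ofL.comp g)).eval (ofL (e (some i₁))) -
            ((πR.map (ofL.comp g)).eval (ofL (e (some i₁))) - (π.map ιT).eval (e' (some i₁))) := by ring
        rw [e1]
        exact Ideal.sub_mem _ (Ideal.subset_span (by simp)) (hsv hdiff)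
    · -- old ⊆ new
      have hv_new : v ∈ Ideal.span {φ (MvPowerSeries.X (some i₀)), e' none, (π.map ιT).eval (e' (some i₁))} := by
        rw [hv_eq]; exact Ideal.mul_mem_right _ _ (Ideal.subset_span (by simp))
      have hsv : Ideal.span {v} ≤ Ideal.span {φ (MvPowerSeries.X (some i₀)), e' none, (π.map ιT).eval (e' (some i₁))} :=
        (Ideal.span_singleton_le_iff_mem _).2 hv_new
      rw [Ideal.span_le]
      rintro t ht
      simp only [Set.mem_insert_iff, Set.mem_singleton_iff] at ht
      rw [SetLike.mem_coe]
      rcases ht with rfl | rfl | rfl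
      · exact hv_new
      · have e1 : ofL (e none) = e' none - (e' none - ofL (e none)) := by ring
        rw [e1]
        exact Ideal.sub_mem _ (Ideal.subset_span (by simp)) (hsv (he'_sub none))
      · have e1 : (πR.map (ofL.comp g)).eval (ofL (e (some i₁))) = (π.map ιT).eval (e' (some i₁)) +
            ((πR.map (ofL.comp g)).eval (ofL (e (some i₁))) - (π.map ιT).eval (e' (some i₁))) := by ring
        rw [e1]
        exact Ideal.add_mem _ (Ideal.subset_span (by simp)) (hsv hdiff)
  -- residue field: polynomials in `e'_{i₁}` with coefficients from `K`
  have hres' : ∀ x : AdicCompletion (maximalIdeal L) L, ∃ P : Polynomial K, x - (P.map ιT).eval (e' (some i₁)) ∈ maximalIdeal _ := by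
    intro x
    obtain ⟨ybar, hybar⟩ := (AdicCompletion.residueField_map_bijective L).2 (IsLocalRing.residue _ x)
    obtain ⟨y, rfl⟩ := IsLocalRing.residue_surjective ybar
    obtain ⟨P, hP⟩ := hres y
    refine ⟨P.map ev₀, ?_⟩
    have h1 : x - ofL y ∈ maximalIdeal _ := by
      rw [IsLocalRing.ResidueField.map_residue] at hybar
      rw [← Ideal.Quotient.eq]
      exact hybar.symm
    have h2 : ofL y - ofL ((P.map g).eval (e (some i₁))) ∈ maximalIdeal (AdicCompletion (maximalIdeal L) L) := by
      rw [← map_sub, h𝔪C]; exact Ideal.mem_map_of_mem _ hP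
    have h3 : ofL ((P.map g).eval (e (some i₁))) - ((P.map ev₀).map ιT).eval (e' (some i₁)) ∈ maximalIdeal (AdicCompletion (maximalIdeal L) L) := by
      rw [hofLeval]
      exact hspan_v (eval_sub_eval_mem_of_coeff (hPcoef P) (by rw [← Ideal.neg_mem_iff, neg_sub]; exact he'_sub _))
    have e3 : x - ((P.map ev₀).map ιT).eval (e' (some i₁)) = (x - ofL y) + (ofL y - ofL ((P.map g).eval (e (some i₁)))) +
        (ofL ((P.map g).eval (e (some i₁))) - ((P.map ev₀).map ιT).eval (e' (some i₁))) := by ring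
    rw [e3]
    exact Ideal.add_mem _ (Ideal.add_mem _ h1 h2) h3
  have hdim' : ringKrullDim (AdicCompletion (maximalIdeal L) L) = 3 := by rw [ringKrullDim_adicCompletion]; exact hdim
  have hπm' : π.Monic := by rw [← hπR]; exact hπm.map _
  -- the translated point in the Hauser–Wagner frame (over `K′`) and the cleaning series
  set b : Fin 2 → K' := fun l => if l = i₀ then 0 else AdjoinRoot.root π with hb
  have hbi₀ : b i₀ = 0 := by rw [hb]; exact if_pos rfl
  have hbi₁ : b i₁ = AdjoinRoot.root π := by rw [hb]; exact if_neg hi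
  obtain ⟨Q, hQ⟩ := Series.exists_add_pow_eq_step_F p i₀ b S₁ (0 : K')
  set q₀ : K' := MvPowerSeries.constantCoeff Q with hq₀
  set sh : MvPowerSeries (Option (Fin 2)) K' := MvPowerSeries.rename (some : Fin 2 → Option (Fin 2)) Q - MvPowerSeries.C q₀ with hsh
  have hsh0 : MvPowerSeries.constantCoeff sh = 0 := by
    rw [hsh, map_sub, constantCoeff_rename_some, MvPowerSeries.constantCoeff_C, hq₀, sub_self]
  have hsh_kill : MvPowerSeries.subst (fun j : Option (Fin 2) => if j = none then (0 : MvPowerSeries (Option (Fin 2)) K') else MvPowerSeries.X j) sh = sh := by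
    rw [hsh, hq₀]; exact kill_rename_sub_C Q
  -- STEP 1: the sheared chart `E'` over `K′` (non-rational recognition)
  obtain ⟨E', hE'C, hE'i, hE'j, hE'z⟩ :=
    exists_ringEquiv_chart_nr φ hi htwo e' he' π hπm' hgen' hres' hdim' sh hsh0 hsh_kill
  set ψ : MvPowerSeries (Option (Fin 2)) K →+* MvPowerSeries (Option (Fin 2)) K' := (E' : _ →+* MvPowerSeries (Option (Fin 2)) K').comp φ with hψ
  have hψapp : ∀ x, ψ x = E' (φ x) := fun x => rfl
  have hψC : ∀ l, ψ (MvPowerSeries.C l) = MvPowerSeries.C (ιK l) := fun l => hE'C l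
  have hψi : ψ (MvPowerSeries.X (some i₀)) = MvPowerSeries.X (some i₀) := hE'i
  have hψj : ψ (MvPowerSeries.X (some i₁)) = MvPowerSeries.X (some i₀) * (MvPowerSeries.X (some i₁) + MvPowerSeries.C (b i₁)) := by
    rw [hbi₁]; exact hE'j
  have hψz : ψ (MvPowerSeries.X none) = MvPowerSeries.X (some i₀) * (MvPowerSeries.X none + sh) := hE'z
  -- STEP 2: `ψ` is the germ chart substitution after the coefficient extension; the anchor identity
  set r : MvPowerSeries (Fin 2) K' := Q - MvPowerSeries.C q₀ with hr
  have hr_ren : MvPowerSeries.rename (some : Fin 2 → Option (Fin 2)) r = sh := by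
    rw [hr, map_sub, MvPowerSeries.rename_C, hsh]
  have hψz' : ψ (MvPowerSeries.X none) = MvPowerSeries.X (some i₀) * (MvPowerSeries.X none + MvPowerSeries.rename (some : Fin 2 → Option (Fin 2)) r) := by
    rw [hψz, hr_ren]
  have hψj' : ∀ j : Fin 2, j ≠ i₀ → ψ (MvPowerSeries.X (some j)) = MvPowerSeries.X (some i₀) * (MvPowerSeries.X (some j) + MvPowerSeries.C (b j)) := by
    intro j hj
    rcases htwo j with rfl | rfl
    · exact absurd rfl hj
    · exact hψj
  set σ' : Option (Fin 2) → MvPowerSeries (Option (Fin 2)) K' := fun o => o.elim (MvPowerSeries.X (some i₀) * (MvPowerSeries.X none + MvPowerSeries.rename (some : Fin 2 → Option (Fin 2)) r))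
    (fun j => MvPowerSeries.rename (some : Fin 2 → Option (Fin 2)) (chartSubst 2 K' i₀ b j)) with hσ'
  have hσ'sub : MvPowerSeries.HasSubst σ' := hasSubst_chartGerm i₀ b r
  have hψsubst : ∀ f, ψ f = MvPowerSeries.subst σ' (MvPowerSeries.map ιK f) := fun f =>
    ringHom_eq_subst_map_chartGerm ιK ψ hψC i₀ b r hψi hψj' hψz' f
  have hψF : ψ (MvPowerSeries.rename (some : Fin 2 → Option (Fin 2)) S₀.F) =
      MvPowerSeries.X (some i₀) ^ p * MvPowerSeries.rename (some : Fin 2 → Option (Fin 2)) (S₁.pointTransform p i₀ b) := by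
    rw [hψsubst, ← MvPowerSeries.rename_map, ← hS₁F, hσ', subst_chartGerm_rename i₀ b r S₁.F,
      Series.subst_chartSubst_eq p hi htwo b b hbi₀ rfl S₁ ho₁ hpo, map_mul, map_pow, MvPowerSeries.rename_X]
  have hA : ψ (w₀ * (MvPowerSeries.X none ^ p + MvPowerSeries.rename (some : Fin 2 → Option (Fin 2)) S₀.F)) =
      ψ w₀ * (MvPowerSeries.X (some i₀) ^ p * ((MvPowerSeries.X none + sh) ^ p +
        MvPowerSeries.rename (some : Fin 2 → Option (Fin 2)) (S₁.pointTransform p i₀ b))) := by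
    have h1 : (MvPowerSeries.X (some i₀) * (MvPowerSeries.X none + sh)) ^ p =
        MvPowerSeries.X (some i₀) ^ p * (MvPowerSeries.X none + sh) ^ p := by rw [mul_pow]
    rw [map_mul, map_add, map_pow, hψz, hψF, h1]
    ring
  -- rewrite the bracket as `z^p + F'(u) − C (q₀^p)`
  have hbracket : (MvPowerSeries.X none + sh) ^ p + MvPowerSeries.rename (some : Fin 2 → Option (Fin 2)) (S₁.pointTransform p i₀ b) =
      MvPowerSeries.X none ^ p + MvPowerSeries.rename (some : Fin 2 → Option (Fin 2)) (S₁.step p i₀ b).F - MvPowerSeries.C (q₀ ^ p) := by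
    rw [← hQ, hsh]
    simp only [map_add, map_pow, map_zero, add_zero]
    rw [add_pow_char _ _ p, sub_pow_char _ _]
    ring
  rw [hbracket] at hA
  obtain ⟨G, hG⟩ : ∃ G : MvPowerSeries (Option (Fin 2)) K',
      G = MvPowerSeries.X none ^ p + MvPowerSeries.rename (some : Fin 2 → Option (Fin 2)) (S₁.step p i₀ b).F - MvPowerSeries.C (q₀ ^ p) := ⟨_, rfl⟩
  rw [← hG] at hA
  -- STEP 3: `E′ (g f₀) = ψ(w₀) · X_{i₀}^p · G`
  have hEgf₀ : E' (ofL (g f₀)) = ψ w₀ * (MvPowerSeries.X (some i₀) ^ p * G) := by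
    rw [← hĝ_of, ← hφE₀, ← hψapp, hf₀, hA]
  -- STEP 4: `E′ (g c_{i₀}) = X_{i₀} · unit`
  have hσ'i : σ' (some i₀) = MvPowerSeries.X (some i₀) := rename_chartSubst_self i₀ b
  have hσ'mem : ∀ j, σ' j ∈ Ideal.span {(MvPowerSeries.X (some i₀) : (MvPowerSeries (Option (Fin 2)) K'))} := by
    intro j
    cases j with
    | none => exact Ideal.mul_mem_right _ _ (Ideal.subset_span rfl)
    | some k =>
      by_cases hk : k = i₀
      · subst hk; rw [hσ'i]; exact Ideal.subset_span rfl
      · change MvPowerSeries.rename some (chartSubst 2 K' i₀ b k) ∈ _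
        rw [rename_chartSubst_of_ne i₀ b hk]
        exact Ideal.mul_mem_right _ _ (Ideal.subset_span rfl)
  obtain ⟨w₂, hw₂, hEci⟩ : ∃ w₂ : (MvPowerSeries (Option (Fin 2)) K'), IsUnit w₂ ∧
      E' (ofL (g (c (some i₀)))) = MvPowerSeries.X (some i₀) * w₂ := by
    have hcX' : MvPowerSeries.map ιK (E₀ (ofR (c (some i₀)))) - MvPowerSeries.X (some i₀) ∈
        maximalIdeal (MvPowerSeries (Option (Fin 2)) K') ^ 2 := by
      have := hcX (some i₀)
      rw [← Literature.RingTheory.MvPowerSeries.Jets.le_order_iff_mem_maximalIdeal_pow] at this ⊢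
      have e1 : MvPowerSeries.map ιK (E₀ (ofR (c (some i₀)))) - MvPowerSeries.X (some i₀) =
          MvPowerSeries.map ιK (E₀ (ofR (c (some i₀))) - MvPowerSeries.X (some i₀)) := by rw [map_sub, MvPowerSeries.map_X]
      rw [e1, order_map_of_injective ιK ιK.injective]
      exact this
    obtain ⟨w₂, hw₂, h⟩ := exists_isUnit_image_adapted i₀ hσ'sub hσ'i hσ'mem (MvPowerSeries.map ιK (E₀ (ofR (c (some i₀))))) hcX'
    exact ⟨w₂, hw₂, by rw [← hĝ_of, ← hφE₀, ← hψapp, hψsubst, h]⟩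
  have hw₀' : IsUnit (ψ w₀) := hw₀.map ψ
  -- STEP 5: cancel `X_{i₀}^p`: `w₂^p · E′ f′ = ψ(w₀) · G`
  have hEf' : w₂ ^ p * E' (ofL f') = ψ w₀ * G := by
    have h1 : E' (ofL (g f₀)) = (MvPowerSeries.X (some i₀) * w₂) ^ p * E' (ofL f') := by
      rw [hf', map_mul, map_pow, map_mul, map_pow, hEci]
    have h2 : (MvPowerSeries.X (some i₀) : (MvPowerSeries (Option (Fin 2)) K')) ^ p * (w₂ ^ p * E' (ofL f')) =
        MvPowerSeries.X (some i₀) ^ p * (ψ w₀ * G) := by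
      rw [← mul_assoc, ← mul_pow, ← h1, hEgf₀]; ring
    exact mul_left_cancel₀ (pow_ne_zero p (X_some_ne_zero i₀)) h2
  -- STEP 6: singularity upstairs: `G ∈ 𝔪^p`, hence `q₀ = 0` and the point is equimultiple
  have hG𝔪 : G ∈ maximalIdeal (MvPowerSeries (Option (Fin 2)) K') ^ p := by
    have h1 : E' (ofL f') ∈ maximalIdeal (MvPowerSeries (Option (Fin 2)) K') ^ p :=
      ringEquiv_mem_maximalIdeal_pow E' ((mem_maximalIdeal_pow_iff_algebraMap p f').mp hf'𝔪)
    have h2 : ψ w₀ * G ∈ maximalIdeal (MvPowerSeries (Option (Fin 2)) K') ^ p := by rw [← hEf']; exact Ideal.mul_mem_left _ _ h1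
    exact (Ideal.unit_mul_mem_iff_mem _ hw₀').mp h2
  have hXp : (MvPowerSeries.X none : (MvPowerSeries (Option (Fin 2)) K')) ^ p ∈ maximalIdeal (MvPowerSeries (Option (Fin 2)) K') ^ p :=
    Ideal.pow_mem_pow (mem_maximalIdeal_iff_constantCoeff_eq_zero.mpr (MvPowerSeries.constantCoeff_X _)) p
  have hq₀0 : q₀ ^ p = 0 := by
    have hG0 : MvPowerSeries.constantCoeff G = 0 :=
      mem_maximalIdeal_iff_constantCoeff_eq_zero.mp (Ideal.pow_le_self hp.out.ne_zero hG𝔪)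
    have hF'0 : MvPowerSeries.constantCoeff (MvPowerSeries.rename (some : Fin 2 → Option (Fin 2)) (S₁.step p i₀ b).F) = 0 := by
      rw [constantCoeff_rename_some]; exact Series.constantCoeff_step_F p i₀ b S₁
    rw [hG, map_sub, map_add, map_pow, MvPowerSeries.constantCoeff_X, zero_pow hp.out.ne_zero, zero_add, hF'0, zero_sub, MvPowerSeries.constantCoeff_C,
      neg_eq_zero] at hG0
    exact hG0
  have hGeq : G = MvPowerSeries.X none ^ p + MvPowerSeries.rename (some : Fin 2 → Option (Fin 2)) (S₁.step p i₀ b).F := by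
    rw [hG, hq₀0, map_zero, sub_zero]
  have hequi : S₁.IsEquimultiplePoint p i₀ b := by
    have hsh𝔪 : sh ^ p ∈ maximalIdeal (MvPowerSeries (Option (Fin 2)) K') ^ p := Ideal.pow_mem_pow (mem_maximalIdeal_iff_constantCoeff_eq_zero.mpr hsh0) p
    have hev : MvPowerSeries.rename (some : Fin 2 → Option (Fin 2)) (S₁.pointTransform p i₀ b + MvPowerSeries.C ((0 : K') ^ p)) ∈
        maximalIdeal (MvPowerSeries (Option (Fin 2)) K') ^ p := by
      have hx : MvPowerSeries.rename (some : Fin 2 → Option (Fin 2)) (S₁.pointTransform p i₀ b + MvPowerSeries.C ((0 : K') ^ p)) =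
          G - MvPowerSeries.X none ^ p - sh ^ p := by
        rw [hG, ← hbracket, zero_pow hp.out.ne_zero, map_add, MvPowerSeries.rename_C, map_zero, add_zero, add_pow_char _ _ p]; ring
      rw [hx]
      exact Ideal.sub_mem _ (Ideal.sub_mem _ hG𝔪 hXp) hsh𝔪
    exact Series.isEquimultiplePoint_of_le_order_add_C p (le_order_of_mem_maximalIdeal_pow (mem_maximalIdeal_pow_of_rename_some hev))
  -- assemble
  obtain ⟨u₂, hu₂⟩ := hw₂.pow p
  refine ⟨E', ↑u₂⁻¹ * ψ w₀, (u₂⁻¹.isUnit).mul hw₀', fun l => hE'C l, fun h1 l => ?_, hequi, ?_⟩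
  · change b l = 0
    rcases htwo l with rfl | hl
    · exact hbi₀
    · rw [hl, hbi₁, ← AdjoinRoot.mk_X]
      have h2 : AdjoinRoot.mk π Polynomial.X = AdjoinRoot.mk π π := congrArg (fun q => AdjoinRoot.mk π q) (hHW h1).symm
      rw [h2]
      exact AdjoinRoot.mk_self
  · change E' (ofL f') = _
    rw [mul_assoc, ← hGeq, ← hEf', ← hu₂, ← mul_assoc, Units.inv_mul, one_mul]

end Transform

end MohWindowShadeFormalNR

end CampaignW46

end Summit.ResolutionOfSingularities.ResolutionOfSingularities.Theorems

end
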